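import Mathlib

/-!
# Crux-triage r1-2 scratch (refuter-cruxtri-stmt-Langlands-12919-r1-2-0)

Independent kernel checks of the local algebra both Steinberg cards rest on
(`steinberg-hyperplane` First lemma `steinberg_hyperplane`; `transverse-steinberg-ladder`
First lemma `transverse_steinberg_pin`), redone here from scratch because the ideators'
Sketch.lean files are not mountable in this jail.  Entries instead of `GL (Fin 2)`:
`Φ = (a b; 0 d)` = image of Frobenius, `N = (1 x; 0 1)` = image of a generator `τ` of tame
inertia, tame relation `Φ N Φ⁻¹ = N^q` written as `Φ N = N^q Φ`, i.e. on the `(0,1)` entry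
`a x + b = b + q x d`.
-/

namespace TriageR12

/-- Tame relation on a reducible, inertially-unipotent pair pins `(a - q d) x = 0`
(the "Steinberg hyperplane": either unramified, `x = 0`, or `Ψ(Frob) = a/d = q`). -/
theorem tame_pin {A : Type*} [CommRing A] (a b d x : A) (q : ℕ)
    (hrel : a * x + b = b + (q : A) * x * d) : (a - (q : A) * d) * x = 0 := by
  have h : a * x = (q : A) * x * d := by linear_combination hrel
  linear_combination h

/-- Over a domain: genuinely ramified (`x ≠ 0`) reducible points lie on `a = q d`
(ideator 2's `steinberg_hyperplane`, entries form). -/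
theorem hyperplane_of_ramified {A : Type*} [CommRing A] [IsDomain A] (a b d x : A) (q : ℕ)
    (hrel : a * x + b = b + (q : A) * x * d) (hx : x ≠ 0) : a = (q : A) * d := by
  have h := tame_pin a b d x q hrel
  rcases mul_eq_zero.mp h with h0 | h0
  · exact sub_eq_zero.mp h0
  · exact absurd h0 hx

/-- TRANSVERSE orientation over a local ring: if residually `d ≡ q a` (the Steinberg sub-line
`γε` reduces to the global QUOTIENT line) and `1 - q²` is a unit (`Nw² ≢ 1 mod p`), then
`a - q d` is a unit, so the tame relation forces `x = 0` (unramified) and the Steinberg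
characteristic-polynomial condition `(a - q d)(d - q a) = 0` forces `d = q a` EXACTLY
(ideator 3's `transverse_steinberg_pin`, entries form). -/
theorem transverse_pin {A : Type*} [CommRing A] [IsLocalRing A] (a b d x : A) (q : ℕ)
    (ha : IsUnit a) (hrel : a * x + b = b + (q : A) * x * d)
    (hq : IsUnit (1 - (q : A) ^ 2))
    (htrans : d - (q : A) * a ∈ IsLocalRing.maximalIdeal A)
    (hSt : (a - (q : A) * d) * (d - (q : A) * a) = 0) :
    x = 0 ∧ d = (q : A) * a := by
  -- `a - q d = a (1 - q²) - q (d - q a)` : unit minus element of the maximal ideal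
  have hunit : IsUnit (a - (q : A) * d) := by
    have hmem : (q : A) * (d - (q : A) * a) ∈ IsLocalRing.maximalIdeal A :=
      Ideal.mul_mem_left _ _ htrans
    have hu : IsUnit (a * (1 - (q : A) ^ 2)) := ha.mul hq
    have key : a - (q : A) * d = a * (1 - (q : A) ^ 2) - (q : A) * (d - (q : A) * a) := by ring
    rw [key]
    by_contra hnu
    have hmem2 : a * (1 - (q : A) ^ 2) - (q : A) * (d - (q : A) * a) ∈
        IsLocalRing.maximalIdeal A := (IsLocalRing.mem_maximalIdeal _).mpr hnu
    have : a * (1 - (q : A) ^ 2) ∈ IsLocalRing.maximalIdeal A := by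
      have := Ideal.add_mem _ hmem2 hmem
      simpa using this
    exact (IsLocalRing.mem_maximalIdeal _).mp this hu
  refine ⟨?_, ?_⟩
  · have h := tame_pin a b d x q hrel
    exact (hunit.mul_right_eq_zero).mp h
  · have h2 : d - (q : A) * a = 0 := (hunit.mul_right_eq_zero).mp hSt
    exact sub_eq_zero.mp h2

/-- ALIGNED orientation is NOT pinned to unramified: with `a = q d` exactly the tame relation
holds for every `x` (the Kummer direction survives) — the sign claim of card
`transverse-steinberg-ladder`, falsifier (1), checked in the trivial direction. -/
theorem aligned_not_pinned {A : Type*} [CommRing A] (b d x : A) (q : ℕ) :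
    ((q : A) * d) * x + b = b + (q : A) * x * d := by ring

/-- On the reducible locus the level-raising element factors through the pin divisor:
`f_w := tr² − (1+q)² q⁻¹ det` at a diagonal Frobenius `(Ψ₁, Ψ₂) = (a, d)`, multiplied by `q`
to stay polynomial: `q (a + d)² − (1 + q)² a d = (q a − d)(a − q d)`.  Hence `f_w ≡ 0` on the
whole residual-constant (`Ψ = χ̄⁻¹` Teichmüller, `χ̄(Frob_w) q ≡ 1`) characteristic-`p` sheet
`K_p` for EVERY admissible `w` — the genericity lemma of the ladder card ("`f_w ∈ K_i` for a
positive-density set of `w` forces `Ψ_{K_i} ε` of finite image, hence `K_i = ∅`") is false for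
`char p` pieces `K_i`; see TRIAGE.md. -/
theorem levelRaising_factor {A : Type*} [CommRing A] (a d : A) (q : ℕ) :
    (q : A) * (a + d) ^ 2 - (1 + (q : A)) ^ 2 * (a * d) =
      ((q : A) * a - d) * (a - (q : A) * d) := by ring

end TriageR12
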